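import Mathlib
import HarnessLib
import Summits.AtomisticToContinuum.FouriersLaw.Theses.JunctionLocality
import Summits.AtomisticToContinuum.FouriersLaw.Theorems.JunctionLocalityConductanceLowerBoundContactFormationResolventAux1
import Summits.AtomisticToContinuum.FouriersLaw.Theorems.JunctionLocalityConductanceLowerBoundContactCertificateBounds
import Summits.AtomisticToContinuum.FouriersLaw.Theorems.JunctionLocalityConductanceLowerBoundContactCertificateMoments
import Summits.AtomisticToContinuum.FouriersLaw.Theorems.JunctionLocalityConductanceLowerBoundRelocMeanErgodic

/-!
# Contact formation for RESOLVENT fields (stub `stub_contactFormation_resolvent`, R4λ of line `cold-bath-relocation-walk`,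
# crux stmt-AtomisticToContinuum-11749)

THE ADJACENT-CONTACT DEVICE HAS RESOLVENT CONDUCTANCE BOUNDED BELOW UNIFORMLY IN THE PASSIVE TAIL.  For the pinned anharmonic
chain `pinnedChain ω₂ lam β γ` (all parameters `> 0`), `T > 0`, there is `c₀ = c₀(ω₂, lam, β, γ, T) > 0` such that for EVERY
`L ≥ 2` there is `λ₀ = λ₀(L) > 0` with: for all `λ ∈ (0, λ₀)` and every classical `C² ∩ L²(μ_T)` solution `u` of the resolvent
problem with the hot bath on site `0` and the cold bath on site `1`, `λu − (X_H u + γ(S_0 + S_1)u) = p_0² − T`, the Kubo conductance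
functional satisfies `γ(1 − γ⟨u, p_0² − T⟩/T²) ≥ c₀`.

Proof: the CURL CERTIFICATE of the landed `stub_contactFormation` (`λ = 0`), with two `λ`-corrections.
(i) Transmission INEQUALITY `G ≥ (γ³/T)·Y`, `Y = ‖p_0/γ − ∂_{p_0}u‖² + ‖∂_{p_1}u‖²` (`contactResolvent_transmission`: the mass
term `+λ‖u‖²` of the fluctuation–dissipation identity has the right sign).  (ii) With the local test function `φ = p_0F_1 − p_1F_0`
(a backward solution, `contact_testFunction_backward`) the cutoff-removed cross identity for the SHIFTED source `k_0 − λu`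
(`contact_cross`) reads `⟨φ, p_0² − T⟩ − λ⟨φ, u⟩ = ⟨u, p_0A_0 − p_1A_1⟩ = T(⟨∂_{p_0}u, A_0⟩ − ⟨∂_{p_1}u, A_1⟩)`
(`contact_integral_mul_twoMomenta`, curl identity), and `⟨φ, p_0² − T⟩ = 0` (odd in `p`), whence
(†λ) `⟨∂_{p_0}u, A_0⟩ − ⟨∂_{p_1}u, A_1⟩ = −(λ/T)⟨u, φ⟩`.  The GAIN becomes
`⟨∂_{p_1}u, A_1⟩ + ⟨p_0/γ − ∂_{p_0}u, A_0⟩ = (T/γ)E[V''(q_1−q_0)] + (λ/T)⟨u, φ⟩ ≥ T/γ − |λ⟨u, φ⟩|/T`, and by the landed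
MEAN-ERGODIC LEMMA `helper_relocMeanErgodic` (`λ(λ − L_1)⁻¹ → 𝔼_{μ_T}` weakly; source `p_0² − T`, observable `φ`, `⟨φ⟩ = 0`)
`|λ⟨u, φ⟩| < T²/(2γ)` for `λ < λ₀(L)`; so the gain is `≥ T/(2γ)`.  Cauchy–Schwarz: `(T/(2γ))² ≤ Y(‖A_0‖² + ‖A_1‖²) ≤ Y·2KM` with the
`L`-UNIFORM `K, M` of the landed Bounds/Moments files; hence `G ≥ (γ³/T)Y ≥ γT/(8KM) =: c₀`.

References: Rey-Bellet 2003 Rem. 4.4 (Kubo conductance); Eckmann–Pillet–Rey-Bellet 1999 §3; folklore.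
-/

noncomputable section

open MeasureTheory Filter Topology
open scoped ContDiff
open Literature.MathematicalPhysics.KineticTheory.HeatConduction
open Summit.AtomisticToContinuum.FouriersLaw.Theorems.SuperadditiveResistance.DeviceLiouville
  (kin thermo kin_eq_sq continuous_kin liouvilleOp bathOp)
open Summit.AtomisticToContinuum.FouriersLaw.Cruxes.SuperadditiveResistance.FloatingProbeBypassLaplacian
  (pinnedChain_memLp_two_snd pinnedChain_memLp_two_snd_sq)
open Literature.Barriers.AtomisticToContinuum (pinnedChain_deriv_deriv_U)

namespace Summit.AtomisticToContinuum.FouriersLaw.Cruxes.ConductanceLowerBound.ColdBathRelocationWalk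

/-- **R4λ — CONTACT FORMATION FOR RESOLVENT FIELDS (uniform in the passive-tail length).**  The adjacent-contact device — hot bath
on site `0`, cold bath on site `1`, passive tail `2, …, L−1`, all at `T` — has resolvent Kubo conductance bounded below UNIFORMLY IN `L`
for small `λ`: `∃ c₀ > 0 ∀ L ≥ 2 ∃ λ₀ > 0 ∀ λ ∈ (0, λ₀)`, `γ(1 − γ⟨u, p_0² − T⟩_{μ_T}/T²) ≥ c₀` for every classical `C² ∩ L²(μ_T)`
solution `u` of `λu − (X_H u + γ(S_0 + S_1) u) = p_0² − T` (the curl certificate `φ = p_0F_1 − p_1F_0` plus the mean-ergodic lemma;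
see the module docstring). [folklore] -/
theorem stub_contactFormation_resolvent :
    ∀ (ω₂ lam β γ T : ℝ), 0 < ω₂ → 0 < lam → 0 < β → 0 < γ → 0 < T →
      ∃ c₀ : ℝ, 0 < c₀ ∧ ∀ (L : ℕ), 2 ≤ L → ∃ l₀ : ℝ, 0 < l₀ ∧ ∀ (l : ℝ), 0 < l → l < l₀ →
        ∀ u : PhaseSpace L → ℝ, ContDiff ℝ 2 u → MemLp u 2 ((pinnedChain ω₂ lam β γ).gibbsMeasure L T) →
        (∀ x, l * u x - (liouvilleOp (pinnedChain ω₂ lam β γ) L u x + γ * (thermo L 0 T u x + thermo L 1 T u x)) =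
          kin L 0 x - T) →
        c₀ ≤ γ * (1 - γ / T ^ 2 * ∫ x, u x * (kin L 0 x - T) ∂((pinnedChain ω₂ lam β γ).gibbsMeasure L T)) := by
  -- adapted from the landed `stub_contactFormation` (λ = 0), lead c2
  intro ω₂ lam β γ T hω hl hβ hγ hT
  obtain ⟨K, hK, hKb⟩ := contact_realBounds ω₂ lam β γ
  obtain ⟨M, hM, hMb⟩ := contact_gibbsPolynomialMoments ω₂ lam β γ hω hl.le hβ.le T hT
  have hM0 : 0 < M := zero_lt_one.trans_le hM
  have hKM : 0 < 8 * K * M := by positivity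
  refine ⟨γ * T / (8 * K * M), by positivity, fun L hL => ?_⟩
  -- ## sites, forces, the objects of the certificate (independent of `λ` and `u`)
  have h0 : 0 < L := by omega
  have h1 : 1 < L := by omega
  obtain ⟨hQ0, j2, ε, hε0, hε1, hj2, hQ1⟩ :=
    contact_forcesClosedForm (ω₂ := ω₂) (lam := lam) (β := β) (γ := γ) hL (i0 := ⟨0, h0⟩) (i1 := ⟨1, h1⟩) rfl rfl
  set i0 : Fin L := ⟨0, h0⟩ with hi0
  set i1 : Fin L := ⟨1, h1⟩ with hi1
  have h01 : i0 ≠ i1 := fun h => by simpa [hi0, hi1] using congrArg Fin.val h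
  set P := pinnedChain ω₂ lam β γ with hP
  set μ := P.gibbsMeasure L T with hμ
  haveI : IsProbabilityMeasure μ := pinnedChain_isProbabilityMeasure_gibbsMeasure hω hl.le hβ.le γ L hT
  set F0 : PhaseSpace L → ℝ := fun y => -partialQ i0 (P.hamiltonian L) y with hF0def
  set F1 : PhaseSpace L → ℝ := fun y => -partialQ i1 (P.hamiltonian L) y with hF1def
  have hF0 : F0 = fun y => -deriv P.U (y.1 i0) + deriv P.V (y.1 i1 - y.1 i0) := by
    funext y; simp only [hF0def, hQ0 y]; ring
  have hF1 : F1 = fun y => -deriv P.U (y.1 i1) - deriv P.V (y.1 i1 - y.1 i0) + ε * deriv P.V (y.1 j2 - y.1 i1) := by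
    funext y; simp only [hF1def, hQ1 y]; ring
  have hF0H : ∀ x, F0 x = -partialQ i0 (P.hamiltonian L) x := fun x => rfl
  have hF1H : ∀ x, F1 x = -partialQ i1 (P.hamiltonian L) x := fun x => rfl
  set A0 : PhaseSpace L → ℝ := fun y => γ * F1 y + liouvilleOp P L F1 y with hA0def
  set A1 : PhaseSpace L → ℝ := fun y => γ * F0 y + liouvilleOp P L F0 y with hA1def
  set φ : PhaseSpace L → ℝ := fun y => y.2 i0 * F1 y - y.2 i1 * F0 y with hφdef
  set kφ : PhaseSpace L → ℝ := fun y => y.2 i0 * A0 y - y.2 i1 * A1 y with hkφdef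
  set W : PhaseSpace L → ℝ := fun y => deriv (deriv P.V) (y.1 i1 - y.1 i0) with hWdef
  -- ## regularity
  have hF0s : ContDiff ℝ 2 F0 := contact_contDiff_F0 hF0
  have hF1s : ContDiff ℝ 2 F1 := contact_contDiff_F1 hF1
  have hddU : ContDiff ℝ 2 (deriv (deriv P.U)) := contact_contDiff_ddU ω₂ lam β γ
  have hddV : ContDiff ℝ 2 (deriv (deriv P.V)) := contact_contDiff_ddV ω₂ lam β γ
  have hX0fun : liouvilleOp P L F0 = fun y => -deriv (deriv P.U) (y.1 i0) * y.2 i0 +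
      deriv (deriv P.V) (y.1 i1 - y.1 i0) * (y.2 i1 - y.2 i0) := funext (contact_liouvilleOp_F0 hF0)
  have hX1fun : liouvilleOp P L F1 = fun y => -deriv (deriv P.U) (y.1 i1) * y.2 i1 -
      deriv (deriv P.V) (y.1 i1 - y.1 i0) * (y.2 i1 - y.2 i0) +
      ε * (deriv (deriv P.V) (y.1 j2 - y.1 i1) * (y.2 j2 - y.2 i1)) := funext (contact_liouvilleOp_F1 hF1)
  have hX0s : ContDiff ℝ 2 (liouvilleOp P L F0) := by rw [hX0fun]; fun_prop
  have hX1s : ContDiff ℝ 2 (liouvilleOp P L F1) := by rw [hX1fun]; fun_prop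
  have hA0s : ContDiff ℝ 2 A0 := (contDiff_const.mul hF1s).add hX1s
  have hA1s : ContDiff ℝ 2 A1 := (contDiff_const.mul hF0s).add hX0s
  have hφs : ContDiff ℝ 2 φ := ((contact_contDiff_snd i0).mul hF1s).sub ((contact_contDiff_snd i1).mul hF0s)
  have hkφs : ContDiff ℝ 2 kφ := ((contact_contDiff_snd i0).mul hA0s).sub ((contact_contDiff_snd i1).mul hA1s)
  have hpA0s : ContDiff ℝ 2 fun x : PhaseSpace L => x.2 i0 * A0 x := (contact_contDiff_snd i0).mul hA0s
  have hpA1s : ContDiff ℝ 2 fun x : PhaseSpace L => x.2 i1 * A1 x := (contact_contDiff_snd i1).mul hA1s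
  have hWc : Continuous W := hddV.continuous.comp (by fun_prop)
  have hA0d : Differentiable ℝ A0 := hA0s.differentiable two_ne_zero
  have hA1d : Differentiable ℝ A1 := hA1s.differentiable two_ne_zero
  -- ## pointwise polynomial bounds, hence `L`-uniform second moments
  have hbounds : ∀ x : PhaseSpace L,
      A0 x ^ 2 ≤ K * (1 + x.1 i0 ^ 2 + x.1 i1 ^ 2 + x.1 j2 ^ 2 + x.2 i0 ^ 2 + x.2 i1 ^ 2 + x.2 j2 ^ 2) ^ 4 ∧
      A1 x ^ 2 ≤ K * (1 + x.1 i0 ^ 2 + x.1 i1 ^ 2 + x.1 j2 ^ 2 + x.2 i0 ^ 2 + x.2 i1 ^ 2 + x.2 j2 ^ 2) ^ 4 ∧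
      (x.2 i0 * A0 x) ^ 2 ≤ K * (1 + x.1 i0 ^ 2 + x.1 i1 ^ 2 + x.1 j2 ^ 2 + x.2 i0 ^ 2 + x.2 i1 ^ 2 + x.2 j2 ^ 2) ^ 4 ∧
      (x.2 i1 * A1 x) ^ 2 ≤ K * (1 + x.1 i0 ^ 2 + x.1 i1 ^ 2 + x.1 j2 ^ 2 + x.2 i0 ^ 2 + x.2 i1 ^ 2 + x.2 j2 ^ 2) ^ 4 ∧
      φ x ^ 2 ≤ K * (1 + x.1 i0 ^ 2 + x.1 i1 ^ 2 + x.1 j2 ^ 2 + x.2 i0 ^ 2 + x.2 i1 ^ 2 + x.2 j2 ^ 2) ^ 4 ∧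
      kφ x ^ 2 ≤ K * (1 + x.1 i0 ^ 2 + x.1 i1 ^ 2 + x.1 j2 ^ 2 + x.2 i0 ^ 2 + x.2 i1 ^ 2 + x.2 j2 ^ 2) ^ 4 ∧
      W x ^ 2 ≤ K * (1 + x.1 i0 ^ 2 + x.1 i1 ^ 2 + x.1 j2 ^ 2 + x.2 i0 ^ 2 + x.2 i1 ^ 2 + x.2 j2 ^ 2) ^ 4 := by
    intro x
    have hb := hKb ε (x.1 i0) (x.1 i1) (x.1 j2) (x.2 i0) (x.2 i1) (x.2 j2) _ hε0 hε1 rfl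
    have eF0 : F0 x = -(ω₂ * x.1 i0 + lam * x.1 i0 ^ 3) + ((x.1 i1 - x.1 i0) + β * (x.1 i1 - x.1 i0) ^ 3) := by
      rw [hF0]; simp only [hP, pinnedChain_deriv_U, pinnedChain_deriv_V]
    have eF1 : F1 x = -(ω₂ * x.1 i1 + lam * x.1 i1 ^ 3) - ((x.1 i1 - x.1 i0) + β * (x.1 i1 - x.1 i0) ^ 3) +
        ε * ((x.1 j2 - x.1 i1) + β * (x.1 j2 - x.1 i1) ^ 3) := by
      rw [hF1]; simp only [hP, pinnedChain_deriv_U, pinnedChain_deriv_V]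
    have eX0 : liouvilleOp P L F0 x = -(ω₂ + 3 * lam * x.1 i0 ^ 2) * x.2 i0 +
        (1 + 3 * β * (x.1 i1 - x.1 i0) ^ 2) * (x.2 i1 - x.2 i0) := by
      rw [hX0fun]; simp only [hP, pinnedChain_deriv_deriv_U, pinnedChain_deriv_deriv_V]
    have eX1 : liouvilleOp P L F1 x = -(ω₂ + 3 * lam * x.1 i1 ^ 2) * x.2 i1 -
        (1 + 3 * β * (x.1 i1 - x.1 i0) ^ 2) * (x.2 i1 - x.2 i0) +
        ε * ((1 + 3 * β * (x.1 j2 - x.1 i1) ^ 2) * (x.2 j2 - x.2 i1)) := by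
      rw [hX1fun]; simp only [hP, pinnedChain_deriv_deriv_U, pinnedChain_deriv_deriv_V]
    have eW : W x = 1 + 3 * β * (x.1 i1 - x.1 i0) ^ 2 := by
      simp only [hWdef, hP, pinnedChain_deriv_deriv_V]
    simp only [hA0def, hA1def, hφdef, hkφdef]
    rw [eX0, eX1, eF0, eF1, eW]
    exact hb
  have mA0 := hMb L i0 i1 j2 K A0 hK.le hA0s.continuous fun x => (hbounds x).1
  have mA1 := hMb L i0 i1 j2 K A1 hK.le hA1s.continuous fun x => (hbounds x).2.1
  have mpA0 := hMb L i0 i1 j2 K (fun x => x.2 i0 * A0 x) hK.le hpA0s.continuous fun x => (hbounds x).2.2.1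
  have mpA1 := hMb L i0 i1 j2 K (fun x => x.2 i1 * A1 x) hK.le hpA1s.continuous fun x => (hbounds x).2.2.2.1
  have mφ := hMb L i0 i1 j2 K φ hK.le hφs.continuous fun x => (hbounds x).2.2.2.2.1
  have mkφ := hMb L i0 i1 j2 K kφ hK.le hkφs.continuous fun x => (hbounds x).2.2.2.2.2.1
  have mW := hMb L i0 i1 j2 K W hK.le hWc fun x => (hbounds x).2.2.2.2.2.2
  -- ## the test function is odd in the momenta: `∫ φ dμ_T = 0`; the source `p_0² − T` is smooth and in `L²(μ_T)`
  have hφmean : ∫ x, φ x ∂μ = 0 :=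
    contact_integral_eq_zero_of_odd P L T fun x => contact_phi_neg_momentum hF0 hF1 x
  have hk0s : ContDiff ℝ ∞ (fun x : PhaseSpace L => kin L 0 x - T) := contDiff_kin_sub_const L 0 T
  have hk0L2 : MemLp (fun x => kin L 0 x - T) 2 μ :=
    ((pinnedChain_memLp_two_snd_sq hω hl.le hβ.le γ L hT i0).sub (memLp_const T)).ae_eq
      (ae_of_all _ fun x => by simp [kin_eq_sq h0, hi0])
  -- ## the threshold `λ₀(L)`: the mean-ergodic lemma for `L_1`, source `p_0² − T`, observable `φ`
  obtain ⟨l₀, hl₀, hME⟩ := helper_relocMeanErgodic ω₂ lam β γ T hω hl.le hβ.le hγ hT L 1 h0 1 one_ne_zero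
    (fun x => kin L 0 x - T) φ hk0s hk0L2 mφ.1 (T ^ 2 / (2 * γ)) (by positivity)
  refine ⟨l₀, hl₀, fun l hlpos hll u huC hu2 hres => ?_⟩
  have hsmall : |l * ∫ x, u x * φ x ∂μ| < T ^ 2 / (2 * γ) := by
    have h := hME l hlpos hll u huC hu2 (fun x => by rw [one_mul]; exact hres x)
    rwa [hφmean, mul_zero, sub_zero] at h
  -- ## transmission inequality and the contact gradients
  obtain ⟨hga, hgb, hG⟩ := contactResolvent_transmission hω hl.le hβ.le hγ hT hL hlpos.le huC hu2 hres
  -- ## the forward pair (SHIFTED source) and the backward pair; the cross identity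
  set B : Fin L → ℝ := fun i => (if i.val = 0 then 1 else 0) + (if i.val = 1 then 1 else 0) with hBdef
  have hBnn : ∀ i, 0 ≤ B i := fun i => contact_twoWeights_nonneg i
  have hpg : ∀ x, 1 * liouvilleOp P L u x + γ * bathOp L B T u x = -((kin L 0 x - T) - l * u x) :=
    fun x => contactResolvent_pair hres x
  have hph : ∀ x, -1 * liouvilleOp P L φ x + γ * bathOp L B T φ x = -kφ x := fun x =>
    contact_testFunction_backward rfl rfl hF0 hF1 hF0H hF1H T x
  have hkfL2 : MemLp (fun x => (kin L 0 x - T) - l * u x) 2 μ := hk0L2.sub (hu2.const_mul l)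
  have hcross := contact_cross hω hl.le hβ.le γ L hT B hBnn hγ huC hφs hu2 hkfL2 mφ.1 mkφ.1 hpg hph
  have hodd : ∫ x, φ x * (kin L 0 x - T) ∂μ = 0 := by
    refine contact_integral_eq_zero_of_odd P L T fun x => ?_
    have hφodd := contact_phi_neg_momentum hF0 hF1 x
    show φ (x.1, -x.2) * (kin L 0 (x.1, -x.2) - T) = -(φ x * (kin L 0 x - T))
    rw [kin_eq_sq h0, kin_eq_sq h0]
    simp only [hφdef] at hφodd ⊢
    rw [hφodd]
    simp only [Pi.neg_apply]
    ring
  have hsplit : ∫ x, φ x * ((kin L 0 x - T) - l * u x) ∂μ =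
      (∫ x, φ x * (kin L 0 x - T) ∂μ) - l * ∫ x, u x * φ x ∂μ := by
    have i1 : Integrable (fun x => φ x * (kin L 0 x - T)) μ := mφ.1.integrable_mul hk0L2
    have i2 : Integrable (fun x => u x * φ x) μ := hu2.integrable_mul mφ.1
    rw [← integral_const_mul, ← integral_sub i1 (i2.const_mul l)]
    exact integral_congr_ae (ae_of_all _ fun x => by ring)
  -- ## (†λ) by one Gaussian integration by parts in each momentum, with the curl identity
  have hWa : ∀ x, partialP i0 A0 x = W x := contact_partialP_zero_A0 h01 hj2 hF1
  have hWb : ∀ x, partialP i1 A1 x = W x := contact_partialP_one_A1 h01 hF0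
  have htwo := contact_integral_mul_twoMomenta hω hl.le hβ.le γ L hT i0 i1 huC hA0d hA1d hWa hWb hu2 hga hgb
    mA0.1 mA1.1 mpA0.1 mpA1.1 mW.1
  have hdag : T * ((∫ x, partialP i0 u x * A0 x ∂μ) - ∫ x, partialP i1 u x * A1 x ∂μ) =
      -(l * ∫ x, u x * φ x ∂μ) := by
    rw [← htwo, ← hcross, hsplit, hodd]
    ring
  -- ## the gain `⟨p_0, A_0⟩ = T E[V''(q_1 − q_0)] ≥ T`
  have iA0 : Integrable A0 μ := mA0.1.integrable one_le_two
  have ipA0 : Integrable (fun x => x.2 i0 * A0 x) μ := mpA0.1.integrable one_le_two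
  have iW : Integrable W μ := mW.1.integrable one_le_two
  have hgain : ∫ x, x.2 i0 * A0 x ∂μ = T * ∫ x, W x ∂μ := by
    have idA0 : Integrable (partialP i0 A0) μ := iW.congr (ae_of_all _ fun x => (hWa x).symm)
    rw [contact_integral_snd_mul hω hl.le hβ.le γ L hT i0 hA0d iA0 ipA0 idA0]
    congr 1
    exact integral_congr_ae (ae_of_all _ hWa)
  have hWge : 1 ≤ ∫ x, W x ∂μ := by
    have := integral_mono (integrable_const (1 : ℝ)) iW fun x => contact_one_le_ddV ω₂ lam γ hβ.le (x.1 i1 - x.1 i0)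
    simpa using this
  -- ## Cauchy–Schwarz
  set w : PhaseSpace L → ℝ := fun x => γ⁻¹ * x.2 i0 - partialP i0 u x with hwdef
  have hp0 : MemLp (fun x : PhaseSpace L => x.2 i0) 2 μ := pinnedChain_memLp_two_snd hω hl.le hβ.le γ L hT i0
  have hwL2 : MemLp w 2 μ := (hp0.const_mul γ⁻¹).sub hga
  have hIw : ∫ x, w x * A0 x ∂μ = γ⁻¹ * (∫ x, x.2 i0 * A0 x ∂μ) - ∫ x, partialP i0 u x * A0 x ∂μ := by
    have ia : Integrable (fun x => γ⁻¹ * (x.2 i0 * A0 x)) μ := ipA0.const_mul _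
    have ib : Integrable (fun x => partialP i0 u x * A0 x) μ := hga.integrable_mul mA0.1
    rw [← integral_const_mul, ← integral_sub ia ib]
    exact integral_congr_ae (ae_of_all _ fun x => by simp only [hwdef]; ring)
  have hCS := contact_sq_add_integral_mul_le hgb mA1.1 hwL2 mA0.1
  -- ## assembly: the gain is at least `T/(2γ)` for `λ < λ₀(L)`
  have hΓ : T * γ⁻¹ / 2 ≤ (∫ x, partialP i1 u x * A1 x ∂μ) + ∫ x, w x * A0 x ∂μ := by
    have hX := (abs_lt.1 hsmall).1
    have hD' : (∫ x, partialP i1 u x * A1 x ∂μ) - ∫ x, partialP i0 u x * A0 x ∂μ =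
        (l * ∫ x, u x * φ x ∂μ) / T := by
      field_simp
      linarith [hdag]
    have e1 : (∫ x, partialP i1 u x * A1 x ∂μ) + ∫ x, w x * A0 x ∂μ =
        γ⁻¹ * (T * ∫ x, W x ∂μ) + (l * ∫ x, u x * φ x ∂μ) / T := by
      rw [hIw, hgain, ← hD']
      ring
    have e2 : T * γ⁻¹ ≤ γ⁻¹ * (T * ∫ x, W x ∂μ) := by
      rw [show T * γ⁻¹ = γ⁻¹ * (T * 1) by ring]
      exact mul_le_mul_of_nonneg_left (mul_le_mul_of_nonneg_left hWge hT.le) (inv_nonneg.2 hγ.le)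
    have e3 : -(T * γ⁻¹ / 2) ≤ (l * ∫ x, u x * φ x ∂μ) / T := by
      have h3 : -(T ^ 2 / (2 * γ)) / T ≤ (l * ∫ x, u x * φ x ∂μ) / T := div_le_div_of_nonneg_right hX.le hT.le
      have e4 : -(T ^ 2 / (2 * γ)) / T = -(T * γ⁻¹ / 2) := by
        field_simp
      linarith [h3, e4.le, e4.ge]
    rw [e1]
    linarith
  have hΓ0 : 0 ≤ T * γ⁻¹ / 2 := by positivity
  have hΓ2 : (T * γ⁻¹ / 2) ^ 2 ≤ ((∫ x, partialP i1 u x * A1 x ∂μ) + ∫ x, w x * A0 x ∂μ) ^ 2 :=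
    pow_le_pow_left₀ hΓ0 hΓ 2
  have hN0 : 0 ≤ (∫ x, partialP i1 u x ^ 2 ∂μ) + ∫ x, w x ^ 2 ∂μ :=
    add_nonneg (integral_nonneg fun x => sq_nonneg _) (integral_nonneg fun x => sq_nonneg _)
  have hDle : (∫ x, A1 x ^ 2 ∂μ) + ∫ x, A0 x ^ 2 ∂μ ≤ 2 * K * M := by linarith [mA0.2, mA1.2]
  have hY : (T * γ⁻¹ / 2) ^ 2 ≤ ((∫ x, partialP i1 u x ^ 2 ∂μ) + ∫ x, w x ^ 2 ∂μ) * (2 * K * M) :=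
    hΓ2.trans (hCS.trans (mul_le_mul_of_nonneg_left hDle hN0))
  have hY' : T ^ 2 ≤ γ ^ 2 * (((∫ x, w x ^ 2 ∂μ) + ∫ x, partialP i1 u x ^ 2 ∂μ) * (8 * K * M)) := by
    have e1 : (T * γ⁻¹ / 2) ^ 2 = T ^ 2 / (4 * γ ^ 2) := by
      field_simp
      ring
    rw [e1, div_le_iff₀ (by positivity)] at hY
    linarith
  refine le_trans ?_ hG
  rw [div_le_iff₀ hKM]
  calc γ * T = γ / T * T ^ 2 := by field_simp
    _ ≤ γ / T * (γ ^ 2 * (((∫ x, w x ^ 2 ∂μ) + ∫ x, partialP i1 u x ^ 2 ∂μ) * (8 * K * M))) :=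
        mul_le_mul_of_nonneg_left hY' (by positivity)
    _ = γ ^ 3 / T * ((∫ x, w x ^ 2 ∂μ) + ∫ x, partialP i1 u x ^ 2 ∂μ) * (8 * K * M) := by ring

end Summit.AtomisticToContinuum.FouriersLaw.Cruxes.ConductanceLowerBound.ColdBathRelocationWalk

end
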